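import Literature.Probability.LatticeModels.PSPolymerBounds
import HarnessLib

/-!
# Pirogov–Sinai theory, VI: pointwise stability of one of two phases

Topic `Literature/Probability/LatticeModels`. The core of the Pirogov–Sinai analysis of a two-phase
contour model in the derivative-free, *pointwise* form needed for first-order transitions
(Friedli–Velenik 2017, §7.3–§7.4.3, Prop. 7.34 without (7.67), (7.69)–(7.70)): a `ContourModel` is an
abstract contour setup with local weights `ρ(γ) ≥ 0`, ground weights `w_σ > 0` and partition
functions `Z_σ(V) > 0` tied by the **external-contour representation** (7.29)/(7.30)
(`ContourModel.Rec`), from which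

* the polymer representation (7.34) `Z_σ(V) = w_σ^{|V|} Σ_{Δ compatible} Π K_σ` with the weights
  `K_σ(γ) = ρ(γ) Π_A Z_{lab A}(A)/Z_σ(A)` (7.33)/(7.35) (`Z_div_eq_compSum`);
* truncated weights `K̂ = min(K, e^{-τ̂|γ̄|})`, truncated pressures `ψ̂_σ = log w_σ + ĝ_σ`, the excess
  `a_σ = max ψ̂ - ψ̂_σ` and stability of contours (here: `a_σ |γ̄|^d ≤ |γ̄|`, using `|int γ| ≤ |γ̄|^d`);
* towards **Prop. 7.34, pointwise**: the volume bound `Z_σ(V) ≤ e^{ψ̂|V| + 2|∂V|}` as the induction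
  hypothesis `VolBound`, the bookkeeping of exteriors/interiors, the choice of the cut-off size `L₀`
  (`exists_L0`), the smallness of the truncated activities `K̂`, `Wst`, `Wstar`, some phase having zero
  excess (`exists_excess_eq_zero`), and step (II) of the proof: under `VolBound` for the interiors, a
  stable contour has `K = K̂ ≤ e^{-τ̂|γ̄|}` (`K_le_exp_of_stable`).

The induction closing Prop. 7.34 and its consequences (all contours `τ̂`-stable when `a_σ = 0`, the
dominant phase has `a_σ = 0`, the Lemma 7.26 bound) are in the follow-up file `PSStabilityInduction`.

Everything is proved; no named facts.

## References

* S. Friedli, Y. Velenik, *Statistical Mechanics of Lattice Systems*, CUP 2017, §7.3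
  (eqs. (7.29)–(7.35), Lemma 7.26), §7.4.1–§7.4.3 (Def. 7.33, Prop. 7.34 and its proof,
  eqs. (7.77)–(7.89)). [FriedliVelenik2017]
* M. Zahradník, Comm. Math. Phys. 93 (1984) 559–581 (truncated contour models). [cite via FriedliVelenik2017, §7.6.5]
-/

noncomputable section

open Finset Relation

namespace Literature.Probability.LatticeModels

variable {d : ℕ}

/-- **A two-phase contour model** (Friedli–Velenik §7.3, abstracted): an abstract contour setup with
local contour weights `ρ(γ) ≥ 0` (the surface factor `e^{-β‖γ‖}` of (7.30), already normalised by
the ground weight of the support), ground weights `w_σ > 0` per site (`e^{-β e_σ}`) and positive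
partition functions `Z_σ(V)`. [cite: FriedliVelenik2017, §7.3, eqs. (7.27)–(7.30)] -/
structure ContourModel (d : ℕ) extends ContourSetup d where
  /-- the local weight of a contour -/
  ρ : Γ → ℝ
  /-- the ground weight per site of a phase -/
  w : Phase → ℝ
  /-- the partition function with boundary condition `σ` in the volume `V` -/
  Z : Phase → Finset (Site d) → ℝ
  /-- local weights are non-negative -/
  ρ_nonneg : ∀ γ, 0 ≤ ρ γ
  /-- ground weights are positive -/
  w_pos : ∀ σ, 0 < w σ
  /-- partition functions are positive -/
  Z_pos : ∀ σ V, 0 < Z σ V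

namespace ContourModel

open ContourSetup

variable (M : ContourModel d)

/-- The weight of an external contour in the representation (7.30):
`G(γ) = ρ(γ) Π_{A ∈ ints γ} Z_{lab A}(A) / w_{type γ}^{|A|}`. [cite: FriedliVelenik2017, §7.3, eq. (7.30)] -/
def G (γ : M.Γ) : ℝ := M.ρ γ * ∏ A ∈ M.ints γ, M.Z (M.lab γ A) A / M.w (M.type γ) ^ #A

/-- **The Pirogov–Sinai weight** `K(γ) = ρ(γ) Π_{A ∈ ints γ} Z_{lab A}(A) / Z_{type γ}(A)` (FV eq. (7.33)).
[cite: FriedliVelenik2017, §7.3, eq. (7.33)] -/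
def K (γ : M.Γ) : ℝ := M.ρ γ * ∏ A ∈ M.ints γ, M.Z (M.lab γ A) A / M.Z (M.type γ) A

/-- **The external-contour representation** (FV eqs. (7.29)–(7.30)) as a property of the model: for
every finite volume with `★`-connected complement,
`Z_σ(V) = w_σ^{|V|} Σ_{Γ external family of type σ in V} Π_{γ ∈ Γ} G(γ)`.
[cite: FriedliVelenik2017, §7.3, eqs. (7.29)–(7.30)] -/
structure Rec : Prop where
  /-- the representation in every volume with `★`-connected complement -/
  eq : ∀ (σ : Phase) (V : Finset (Site d)), StarConn (V : Set (Site d))ᶜ →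
    M.Z σ V = M.w σ ^ #V * ∑ Γ ∈ M.ExtFam σ V, ∏ γ ∈ Γ, M.G γ

variable {M}

/-- `G ≥ 0`. [folklore] -/
theorem G_nonneg (γ : M.Γ) : 0 ≤ M.G γ :=
  mul_nonneg (M.ρ_nonneg γ) (prod_nonneg fun _ _ => div_nonneg (M.Z_pos _ _).le (pow_nonneg (M.w_pos _).le _))

/-- `K ≥ 0`. [folklore] -/
theorem K_nonneg (γ : M.Γ) : 0 ≤ M.K γ :=
  mul_nonneg (M.ρ_nonneg γ) (prod_nonneg fun _ _ => div_nonneg (M.Z_pos _ _).le (M.Z_pos _ _).le)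

/-- `G = K · Π_A Z_{type}(A)/w^{|A|}`. [cite: FriedliVelenik2017, §7.3, eqs. (7.31)–(7.33)] -/
theorem G_eq_K_mul (γ : M.Γ) : M.G γ = M.K γ * ∏ A ∈ M.ints γ, M.Z (M.type γ) A / M.w (M.type γ) ^ #A := by
  rw [G, K, mul_assoc, ← prod_mul_distrib]
  congr 1
  refine prod_congr rfl fun A _ => ?_
  rw [div_mul_div_comm, mul_comm (M.Z (M.lab γ A) A), mul_div_mul_left _ _ (M.Z_pos _ _).ne']

/-! ### The polymer representation (7.34) -/

/-- **The polymer representation** (FV eq. (7.34)): under the external-contour representation,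
`Z_σ(V)/w_σ^{|V|} = Σ_{Δ compatible family of type σ in V} Π_{δ ∈ Δ} K(δ)` for every finite `V` with
`★`-connected complement (strong induction on `|V|` through (7.32)).
[cite: FriedliVelenik2017, §7.3, eqs. (7.32)–(7.34)] -/
theorem Z_div_eq_compSum (hd : 2 ≤ d) (hrec : M.Rec) :
    ∀ (N : ℕ) (σ : Phase) (V : Finset (Site d)), StarConn (V : Set (Site d))ᶜ → #V ≤ N →
      M.Z σ V / M.w σ ^ #V = M.compSum σ M.K V := by
  intro N
  induction N with
  | zero =>
    intro σ V hV hN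
    have hV0 : V = ∅ := card_eq_zero.1 (Nat.le_zero.1 hN)
    subst hV0
    rw [hrec.eq σ ∅ hV, card_empty, pow_zero, one_mul, div_one, ContourSetup.compSum]
    -- no contour fits in the empty volume
    have h1 : M.ExtFam σ ∅ = {∅} := by
      refine eq_singleton_iff_unique_mem.2 ⟨empty_mem_extFam σ ∅, fun Γ hΓ => eq_empty_of_forall_notMem fun γ hγ => ?_⟩
      obtain ⟨x, hx⟩ := M.supp_nonempty γ
      exact notMem_empty x (supp_subset_of_inVol ((mem_compFam.1 (mem_extFam.1 hΓ).1).1 γ hγ).2 hx)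
    have h2 : M.CompFam σ ∅ = {∅} := by
      refine eq_singleton_iff_unique_mem.2 ⟨empty_mem_compFam σ ∅, fun Δ hΔ => eq_empty_of_forall_notMem fun γ hγ => ?_⟩
      obtain ⟨x, hx⟩ := M.supp_nonempty γ
      exact notMem_empty x (supp_subset_of_inVol ((mem_compFam.1 hΔ).1 γ hγ).2 hx)
    rw [h1, h2, sum_singleton, sum_singleton, prod_empty, prod_empty]
  | succ N ih =>
    intro σ V hV hN
    rw [hrec.eq σ V hV, mul_div_cancel_left₀ _ (pow_ne_zero _ (M.w_pos σ).ne'), ContourSetup.compSum,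
      sum_compFam_eq_sum_extFam hd hV σ M.K]
    refine sum_congr rfl fun Γ hΓ => prod_congr rfl fun γ hγ => ?_
    have hγ' := (mem_compFam.1 (mem_extFam.1 hΓ).1).1 γ hγ
    rw [G_eq_K_mul, hγ'.1]
    congr 1
    refine prod_congr rfl fun A hA => ?_
    rw [← ContourSetup.compSum, ← ih σ A (starConn_compl_of_mem_ints hd hA) (Nat.lt_succ_iff.1
      (lt_of_lt_of_le (card_lt_of_mem_ints_of_inVol hd hV hγ'.2 hA) hN))]

/-- The polymer representation, cardinal-free form. [cite: FriedliVelenik2017, §7.3, eq. (7.34)] -/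
theorem Z_eq_mul_compSum (hd : 2 ≤ d) (hrec : M.Rec) (σ : Phase) {V : Finset (Site d)} (hV : StarConn (V : Set (Site d))ᶜ) :
    M.Z σ V = M.w σ ^ #V * M.compSum σ M.K V := by
  rw [← Z_div_eq_compSum hd hrec _ σ V hV le_rfl, mul_div_cancel₀ _ (pow_ne_zero _ (M.w_pos σ).ne')]

/-! ### Truncated weights, truncated pressures, stability -/

/-- **The truncated weight** `K̂(γ) = min (K(γ), e^{-τ̂ |γ̄|})` (the hard-cutoff version of FV Def. 7.33,
sufficient for the pointwise theory). [cite: FriedliVelenik2017, §7.4.3, Def. 7.33] -/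
def Khat (M : ContourModel d) (τh : ℝ) (γ : M.Γ) : ℝ := min (M.K γ) (Real.exp (-τh * M.size γ))

/-- `0 ≤ K̂`. [folklore] -/
theorem Khat_nonneg (τh : ℝ) (γ : M.Γ) : 0 ≤ M.Khat τh γ := le_min (K_nonneg γ) (Real.exp_nonneg _)

/-- `K̂ ≤ K`. [cite: FriedliVelenik2017, §7.4.3, eq. (7.62)] -/
theorem Khat_le_K (τh : ℝ) (γ : M.Γ) : M.Khat τh γ ≤ M.K γ := min_le_left _ _

/-- `K̂ ≤ e^{-τ̂|γ̄|}` (`τ̂`-stability of the truncated weights, FV eq. (7.65)). [cite: FriedliVelenik2017, §7.4.3, eq. (7.65)] -/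
theorem Khat_le_exp (τh : ℝ) (γ : M.Γ) : M.Khat τh γ ≤ Real.exp (-τh * M.size γ) := min_le_right _ _

/-- **The truncated pressure of the contours**, `ĝ_σ` (FV eq. (7.75)). [cite: FriedliVelenik2017, §7.4.3, eq. (7.75)] -/
def gHat (M : ContourModel d) (τh : ℝ) (σ : Phase) : ℝ := M.pressureOf σ (M.Khat τh)

/-- **The truncated pressure** `ψ̂_σ = log w_σ + ĝ_σ` (`= -e^σ + ĝ_σ`, FV §7.4.3).
[cite: FriedliVelenik2017, §7.4.3 (ψ̂ⁿ_# = -e^# + ĝⁿ_#)] -/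
def psiHat (M : ContourModel d) (τh : ℝ) (σ : Phase) : ℝ := Real.log (M.w σ) + M.gHat τh σ

/-- `ψ̂ = max_σ ψ̂_σ`. [cite: FriedliVelenik2017, §7.4.3 (ψ̂_n = max_# ψ̂ⁿ_#)] -/
def psiMax (M : ContourModel d) (τh : ℝ) : ℝ := max (M.psiHat τh Phase.ord) (M.psiHat τh Phase.dis)

/-- **The excess** `a_σ = ψ̂ - ψ̂_σ ≥ 0` (FV: `aⁿ_#`). [cite: FriedliVelenik2017, §7.4.3 (aⁿ_# = ψ̂_n - ψ̂ⁿ_#)] -/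
def excess (M : ContourModel d) (τh : ℝ) (σ : Phase) : ℝ := M.psiMax τh - M.psiHat τh σ

/-- `ψ̂_σ ≤ ψ̂`. [folklore] -/
theorem psiHat_le_psiMax (τh : ℝ) (σ : Phase) : M.psiHat τh σ ≤ M.psiMax τh := by
  cases σ
  · exact le_max_left _ _
  · exact le_max_right _ _

/-- `a_σ ≥ 0`. [cite: FriedliVelenik2017, §7.4.3] -/
theorem excess_nonneg (τh : ℝ) (σ : Phase) : 0 ≤ M.excess τh σ := sub_nonneg.2 (psiHat_le_psiMax τh σ)

/-- **Some phase has zero excess** (the maximum is attained). [cite: FriedliVelenik2017, §7.4.3 (min_# aⁿ_# = 0)] -/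
theorem exists_excess_eq_zero (τh : ℝ) : ∃ σ, M.excess τh σ = 0 := by
  rcases le_total (M.psiHat τh Phase.dis) (M.psiHat τh Phase.ord) with h | h
  · exact ⟨Phase.ord, by rw [excess, psiMax, max_eq_left h, sub_self]⟩
  · exact ⟨Phase.dis, by rw [excess, psiMax, max_eq_right h, sub_self]⟩

/-- **A contour is `σ`-stable** if `a_σ |γ̄|^d ≤ |γ̄|` (which implies FV's `a_σ |int γ| ≤ |γ̄|`-type
control since `|int γ| ≤ |γ̄|^d`). [cite: FriedliVelenik2017, §7.4.3 (stable contours: aⁿ_# |int γ|^{1/d} ≤ ρ₀/4)] -/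
def Stable (M : ContourModel d) (τh : ℝ) (σ : Phase) (γ : M.Γ) : Prop := M.excess τh σ * (M.size γ : ℝ) ^ d ≤ M.size γ

/-- Stability is decidable (a real inequality). [folklore] -/
instance (M : ContourModel d) (τh : ℝ) (σ : Phase) (γ : M.Γ) : Decidable (M.Stable τh σ γ) := by
  unfold Stable; infer_instance

/-- With zero excess every contour is stable. [cite: FriedliVelenik2017, §7.4.3 ("when aⁿ_# = 0, all contours are stable")] -/
theorem stable_of_excess_eq_zero {τh : ℝ} {σ : Phase} (h : M.excess τh σ = 0) (γ : M.Γ) : M.Stable τh σ γ := by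
  rw [Stable, h, zero_mul]; exact Nat.cast_nonneg _

/-! ### Geometric bookkeeping: interiors, boundaries and volumes -/

/-- `Σ_{A ∈ ints γ} |A| = |int γ|`. [cite: FriedliVelenik2017, §7.2.6 (int γ = ⋃ int_# γ)] -/
theorem sum_card_ints_eq (hd : 2 ≤ d) (γ : M.Γ) : ∑ A ∈ M.ints γ, #A = #(M.intr γ) := by
  rw [← card_biUnion fun A hA B hB hAB => disjoint_of_mem_ints hd hA hB hAB]
  congr 1
  ext x
  rw [mem_biUnion]
  exact (mem_intr_iff_exists_ints hd).symm

/-- `|∂^ex S| ≤ 3^d |S|`. [folklore] -/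
theorem card_exBoundary_le (S : Finset (Site d)) : #(exBoundary S) ≤ 3 ^ d * #S := by
  refine (card_le_card (sdiff_subset : S.biUnion starBall \ S ⊆ _)).trans (card_biUnion_le.trans ?_)
  rw [mul_comm, sum_const_nat fun x _ => card_starBall x]

/-- `Σ_{A ∈ ints γ} |∂^in A| ≤ 3^d |γ̄|` (the interior boundaries of the interior components are
disjoint subsets of `∂^ex γ̄`). [cite: FriedliVelenik2017, §7.4.1, eq. (7.47) (Σ |∂^ex int_# γ| ≤ |γ̄|, thick version)] -/
theorem sum_card_inBoundary_ints_le (hd : 2 ≤ d) (γ : M.Γ) : ∑ A ∈ M.ints γ, #(inBoundary A) ≤ 3 ^ d * M.size γ := by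
  have hsub : ∀ A ∈ M.ints γ, inBoundary A ⊆ exBoundary (M.supp γ) := by
    intro A hA x hx
    obtain ⟨hxA, y, hyA, hxy⟩ := mem_inBoundary.1 hx
    have hyS : y ∈ M.supp γ := by
      by_contra hyS
      exact hyA (mem_of_adj_of_mem_ints hd hA hxA hyS hxy)
    exact mem_exBoundary.2 ⟨not_mem_supp_of_mem_intr hd (subset_intr_of_mem_ints hA hxA), y, hyS, hxy.symm⟩
  calc ∑ A ∈ M.ints γ, #(inBoundary A) = #((M.ints γ).biUnion inBoundary) := by
        rw [card_biUnion fun A hA B hB hAB => disjoint_of_subset_left (fun x hx => (mem_inBoundary.1 hx).1)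
          (disjoint_of_subset_right (fun x hx => (mem_inBoundary.1 hx).1) (disjoint_of_mem_ints hd hA hB hAB))]
    _ ≤ #(exBoundary (M.supp γ)) := card_le_card (biUnion_subset.2 hsub)
    _ ≤ 3 ^ d * M.size γ := card_exBoundary_le _

/-- The exterior boundary of the hull lies in the exterior boundary of the support. [folklore] -/
theorem exBoundary_hull_subset (hd : 2 ≤ d) (γ : M.Γ) : exBoundary (M.hull γ) ⊆ exBoundary (M.supp γ) := by
  intro y hy
  obtain ⟨hyh, x, hx, hxy⟩ := mem_exBoundary.1 hy
  have hyS : y ∉ M.supp γ := fun h => hyh (supp_subset_hull hd γ h)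
  refine mem_exBoundary.2 ⟨hyS, ?_⟩
  rcases (mem_hull_iff hd).1 hx with hxS | hxi
  · exact ⟨x, hxS, hxy⟩
  · exfalso
    obtain ⟨A, hA, hxA⟩ := (mem_intr_iff_exists_ints hd).1 hxi
    exact hyh (intr_subset_hull γ (subset_intr_of_mem_ints hA (mem_of_adj_of_mem_ints hd hA hxA hyS hxy)))

/-- **Boundary of the outer volume**: `|∂^in (V ∖ ⋃ hull)| ≤ |∂^in V| + 3^d Σ_{γ ∈ Γ} |γ̄|`.
[cite: FriedliVelenik2017, §7.4.3 (|∂^ex Λ^ext| ≤ |∂^ex Λ| + Σ |γ̄'|)] -/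
theorem card_inBoundary_Wvol_le (hd : 2 ≤ d) (V : Finset (Site d)) (Γ : Finset M.Γ) :
    #(inBoundary (M.Wvol V Γ)) ≤ #(inBoundary V) + 3 ^ d * ∑ γ ∈ Γ, M.size γ := by
  have hsub : inBoundary (M.Wvol V Γ) ⊆ inBoundary V ∪ Γ.biUnion fun γ => exBoundary (M.supp γ) := by
    intro x hx
    obtain ⟨hxW, y, hyW, hxy⟩ := mem_inBoundary.1 hx
    obtain ⟨hxV, hxh⟩ := mem_Wvol.1 hxW
    rw [mem_union, mem_biUnion]
    by_cases hyV : y ∈ V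
    · right
      have : ¬ ∀ γ ∈ Γ, y ∉ M.hull γ := fun h => hyW (mem_Wvol.2 ⟨hyV, h⟩)
      push Not at this
      obtain ⟨γ, hγ, hyγ⟩ := this
      exact ⟨γ, hγ, exBoundary_hull_subset hd γ (mem_exBoundary.2 ⟨hxh γ hγ, y, hyγ, hxy.symm⟩)⟩
    · exact Or.inl (mem_inBoundary.2 ⟨hxV, y, hyV, hxy⟩)
  refine (card_le_card hsub).trans ((card_union_le _ _).trans (Nat.add_le_add_left ?_ _))
  refine card_biUnion_le.trans ?_
  rw [mul_sum]
  exact sum_le_sum fun γ _ => card_exBoundary_le _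

/-- `|hull γ| = |γ̄| + |int γ|`. [folklore] -/
theorem card_hull_eq (hd : 2 ≤ d) (γ : M.Γ) : #(M.hull γ) = M.size γ + #(M.intr γ) := by
  have hsub : M.supp γ ⊆ starHullFinset (M.supp γ) := supp_subset_hull hd γ
  have := card_sdiff_add_card_eq_card hsub
  show #(starHullFinset (M.supp γ)) = #(M.supp γ) + #(starHullFinset (M.supp γ) \ M.supp γ)
  omega

/-- **Volume bookkeeping**: `|V| = |V ∖ ⋃ hull| + Σ_{γ ∈ Γ} (|γ̄| + |int γ|)` for an external family `Γ`
of a volume with `★`-connected complement. [cite: FriedliVelenik2017, §7.3 (Λ = Λ^ext ∪ ⋃ (γ̄' ∪ int γ'))] -/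
theorem card_eq_card_Wvol_add (hd : 2 ≤ d) {σ : Phase} {V : Finset (Site d)} (hV : StarConn (V : Set (Site d))ᶜ)
    {Γ : Finset M.Γ} (hΓ : Γ ∈ M.ExtFam σ V) : #V = #(M.Wvol V Γ) + ∑ γ ∈ Γ, (M.size γ + #(M.intr γ)) := by
  obtain ⟨hΓc, hΓd⟩ := mem_extFam.1 hΓ
  have hsub : Γ.biUnion M.hull ⊆ V := biUnion_subset.2 fun γ hγ => hull_subset_of_inVol hd hV ((mem_compFam.1 hΓc).1 γ hγ).2
  rw [Wvol, ← card_sdiff_add_card_eq_card hsub, card_biUnion fun γ hγ γ' hγ' h => hΓd (mem_coe.2 hγ) (mem_coe.2 hγ') h]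
  congr 1
  exact sum_congr rfl fun γ _ => card_hull_eq hd γ

/-! ### Numerical constants -/

/-- `1 + 3^{d+1} ≤ 4^{d+2}` and `3^{d+1} + 1 + 3^d ≤ 4^{d+2}`. [folklore] -/
theorem three_pow_bounds (d : ℕ) : (1 : ℝ) + 3 ^ (d + 1) ≤ 4 ^ (d + 2) ∧ (3 : ℝ) ^ (d + 1) + 1 + 3 ^ d ≤ 4 ^ (d + 2) := by
  have h34 : (3 : ℝ) ^ (d + 1) ≤ 4 ^ (d + 1) := pow_le_pow_left₀ (by norm_num) (by norm_num) _
  have h3 : (3 : ℝ) ^ d ≤ 3 ^ (d + 1) := pow_le_pow_right₀ (by norm_num) (by omega)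
  have h1 : (1 : ℝ) ≤ 4 ^ (d + 1) := one_le_pow₀ (by norm_num)
  have h4 : (4 : ℝ) ^ (d + 2) = 4 * 4 ^ (d + 1) := by rw [pow_succ]; ring
  constructor <;> nlinarith

/-- `8 L^{d-1} ≤ e^{(2d+1) L}` for `L ≥ 1`, `d ≥ 1`. [folklore] -/
theorem eight_mul_pow_le_exp (hd : 1 ≤ d) {L : ℕ} (hL : 1 ≤ L) : 8 * (L : ℝ) ^ (d - 1) ≤ Real.exp ((2 * d + 1) * L) := by
  have hL' : (L : ℝ) ≤ Real.exp L := by have := Real.add_one_le_exp (L : ℝ); linarith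
  have h8 : (8 : ℝ) ≤ Real.exp 3 := by
    have := Real.add_one_le_exp (1 : ℝ)
    have h2 : (2 : ℝ) ≤ Real.exp 1 := by linarith
    calc (8 : ℝ) = 2 ^ 3 := by norm_num
      _ ≤ Real.exp 1 ^ 3 := pow_le_pow_left₀ (by norm_num) h2 3
      _ = Real.exp 3 := by rw [← Real.exp_nat_mul]; norm_num
  calc 8 * (L : ℝ) ^ (d - 1) ≤ Real.exp 3 * Real.exp L ^ (d - 1) := by gcongr
    _ = Real.exp (3 + (d - 1 : ℕ) * L) := by rw [← Real.exp_nat_mul, ← Real.exp_add]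
    _ ≤ Real.exp ((2 * d + 1) * L) := Real.exp_le_exp.2 (by
        have hd' : ((d - 1 : ℕ) : ℝ) = d - 1 := by rw [Nat.cast_sub hd, Nat.cast_one]
        rw [hd']
        have : (1 : ℝ) ≤ L := by exact_mod_cast hL
        have : (1 : ℝ) ≤ d := by exact_mod_cast hd
        nlinarith)

/-- **The scale of the unstable contours**: for `a > 0` there is `L₀` with `a L₀^{d-1} > 1`, minimal,
and then `2 e^{-(2d+1) L₀} ≤ a/4` (`d ≥ 2`). [cite: FriedliVelenik2017, §7.4.3, eq. (7.73)] -/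
theorem exists_L0 (hd : 2 ≤ d) {a : ℝ} (ha : 0 < a) :
    ∃ L₀ : ℕ, 1 ≤ L₀ ∧ (∀ n : ℕ, 1 < a * (n : ℝ) ^ (d - 1) → L₀ ≤ n) ∧ 2 * Real.exp (-(2 * d + 1) * L₀) ≤ a / 4 := by
  classical
  have hex : ∃ L : ℕ, 1 < a * (L : ℝ) ^ (d - 1) := by
    obtain ⟨L, hL⟩ := exists_nat_gt (1 / a)
    refine ⟨L + 1, ?_⟩
    have hL1 : (1 : ℝ) / a < (L + 1 : ℕ) := hL.trans (by push_cast; linarith)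
    have h1 : 1 < a * ((L + 1 : ℕ) : ℝ) := by rwa [div_lt_iff₀ ha, mul_comm] at hL1
    calc (1 : ℝ) < a * ((L + 1 : ℕ) : ℝ) := h1
      _ = a * ((L + 1 : ℕ) : ℝ) ^ 1 := by rw [pow_one]
      _ ≤ a * ((L + 1 : ℕ) : ℝ) ^ (d - 1) := by
          refine mul_le_mul_of_nonneg_left (pow_le_pow_right₀ (by exact_mod_cast Nat.le_add_left 1 L) (by omega)) ha.le
  refine ⟨Nat.find hex, ?_, fun n hn => Nat.find_min' hex hn, ?_⟩
  · by_contra h0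
    have h0' : Nat.find hex = 0 := by omega
    have := Nat.find_spec hex
    rw [h0', Nat.cast_zero, zero_pow (by omega), mul_zero] at this
    exact absurd this (by norm_num)
  · set L₀ := Nat.find hex with hL₀
    have hspec : 1 < a * (L₀ : ℝ) ^ (d - 1) := Nat.find_spec hex
    have hL₀1 : 1 ≤ L₀ := by
      by_contra h0
      have h0' : L₀ = 0 := by omega
      rw [h0', Nat.cast_zero, zero_pow (by omega), mul_zero] at hspec
      exact absurd hspec (by norm_num)
    have h8 := eight_mul_pow_le_exp (d := d) (by omega) hL₀1
    have hpos : (0 : ℝ) < (L₀ : ℝ) ^ (d - 1) := by positivity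
    -- `e^{-(2d+1)L₀} ≤ 1/(8 L₀^{d-1}) < a/8`
    have h1 : Real.exp (-(2 * d + 1) * L₀) * (8 * (L₀ : ℝ) ^ (d - 1)) ≤ 1 := by
      calc Real.exp (-(2 * d + 1) * L₀) * (8 * (L₀ : ℝ) ^ (d - 1))
          ≤ Real.exp (-(2 * d + 1) * L₀) * Real.exp ((2 * d + 1) * L₀) := mul_le_mul_of_nonneg_left h8 (Real.exp_nonneg _)
        _ = 1 := by rw [← Real.exp_add]; ring_nf; rw [Real.exp_zero]
    nlinarith [Real.exp_nonneg (-(2 * d + 1) * (L₀ : ℝ))]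

/-! ### The pressure of the zero weights vanishes -/

/-- The ray derivative of the zero activity vanishes. [folklore] -/
theorem polymerRayDeriv_zero {P : Type*} [DecidableEq P] (inc : P → P → Prop) [DecidableRel inc] (Λ : Finset P) (t : ℝ) :
    polymerRayDeriv inc (0 : P → ℂ) Λ t = 0 := by
  refine sum_eq_zero fun X _ => ?_
  by_cases hX : X = ∅
  · simp [hX]
  · obtain ⟨γ, hγ⟩ := nonempty_iff_ne_empty.2 hX
    rw [prod_eq_zero hγ (Pi.zero_apply _), mul_zero]

/-- The Kotecký–Preiss logarithm of the zero activity vanishes. [folklore] -/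
theorem polymerLogZ_zero {P : Type*} [DecidableEq P] (inc : P → P → Prop) [DecidableRel inc] (Λ : Finset P) :
    polymerLogZ inc (0 : P → ℂ) Λ = 0 := by
  unfold polymerLogZ
  simp [polymerRayDeriv_zero]

/-- The truncated functional of the zero activity vanishes. [folklore] -/
theorem truncatedWeight_zero {P : Type*} [DecidableEq P] (inc : P → P → Prop) [DecidableRel inc] (C : Finset P) :
    truncatedWeight inc (0 : P → ℂ) C = 0 := by
  unfold truncatedWeight
  simp [polymerLogZ_zero]

/-- **The pressure of the zero weights is `0`.** [folklore] -/
theorem pressureOf_zero (σ : Phase) : M.pressureOf σ (fun _ => (0 : ℝ)) = 0 := by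
  have h0 : M.rhoHat σ (fun _ => (0 : ℝ)) = 0 := by
    funext B; rw [rhoHat_eq]; simp
  rw [ContourSetup.pressureOf, h0, polymerPressure, polymerPressureAt]
  simp [truncatedWeight_zero]

/-! ### The three weight systems of the induction and their smallness -/

/-- **The stable truncated weights** of phase `σ`: `K̂` on the `σ`-stable contours, `0` elsewhere
(the weights of `Ξ_stable`, FV §7.4.3). [cite: FriedliVelenik2017, §7.4.3 (Z^#_stable, ĝⁿ_{#,stable})] -/
def Wst (M : ContourModel d) (τh : ℝ) (σ : Phase) (γ : M.Γ) : ℝ :=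
  if M.Stable τh σ γ then M.Khat τh γ else 0

/-- **The weights of the unstable-contour gas** `w_*` (FV eq. after (7.87)):
`ρ(γ) e^{(3^{d+1} + 1 + 3^d)|γ̄|}` on the `σ`-unstable contours, `0` elsewhere.
[cite: FriedliVelenik2017, §7.4.3 (w^#_*(γ))] -/
def Wstar (M : ContourModel d) (τh : ℝ) (σ : Phase) (γ : M.Γ) : ℝ :=
  if M.Stable τh σ γ then 0 else M.ρ γ * Real.exp ((3 ^ (d + 1) + 1 + 3 ^ d) * M.size γ)

/-- `0 ≤ Wst ≤ K̂`. [folklore] -/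
theorem Wst_nonneg_le (τh : ℝ) (σ : Phase) (γ : M.Γ) : 0 ≤ M.Wst τh σ γ ∧ M.Wst τh σ γ ≤ M.Khat τh γ := by
  unfold Wst; split_ifs
  · exact ⟨Khat_nonneg τh γ, le_rfl⟩
  · exact ⟨le_rfl, Khat_nonneg τh γ⟩

/-- `0 ≤ Wstar`. [folklore] -/
theorem Wstar_nonneg (τh : ℝ) (σ : Phase) (γ : M.Γ) : 0 ≤ M.Wstar τh σ γ := by
  unfold Wstar; split_ifs
  · exact le_rfl
  · exact mul_nonneg (M.ρ_nonneg γ) (Real.exp_nonneg _)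

/-- Sizes are translation invariant. [folklore] -/
theorem size_shift (T : M.Shift) (v : Site d) (γ : M.Γ) : M.size (T.shift v γ) = M.size γ := by
  rw [ContourSetup.size, T.supp_shift, card_shiftSet]; rfl

/-- Stability is translation invariant. [folklore] -/
theorem stable_shift_iff (T : M.Shift) (τh : ℝ) (σ : Phase) (v : Site d) (γ : M.Γ) :
    M.Stable τh σ (T.shift v γ) ↔ M.Stable τh σ γ := by
  rw [Stable, Stable, size_shift]

section Smallness

variable (T : M.Shift) {τ : ℝ} (hρτ : ∀ γ, M.ρ γ ≤ Real.exp (-τ * M.size γ))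
  (hρT : ∀ v γ, M.ρ (T.shift v γ) = M.ρ γ) (hKT : ∀ v γ, M.K (T.shift v γ) = M.K γ) {Kc : ℕ}
  (hKc : ∀ A, #(M.withSupp A) ≤ Kc ^ #A)
  (hτ : (Kc : ℝ) * (2 ^ (d + 1) * 9 ^ d) * Real.exp ((2 * d + 2) * 2 ^ d - (τ - 4 ^ (d + 2))) ≤ 1)

include hKT hKc hτ in
/-- **`K̂` merges into a small translation-invariant activity** (`δ = 2d+1`). [cite: FriedliVelenik2017, §7.4.3 ("controlling the truncated pressures")] -/
theorem isSmallTIActivity_Khat (σ : Phase) : IsSmallTIActivity (M.rhoHat σ (M.Khat (τ - 4 ^ (d + 2)))) (2 * d + 1) :=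
  isSmallTIActivity_rhoHat (τ := τ - 4 ^ (d + 2)) T (fun γ => Khat_nonneg _ γ) (fun γ _ => Khat_le_exp _ γ)
    (fun v γ => by rw [Khat, Khat, hKT, size_shift]) hKc (by positivity) (by convert hτ using 3; ring)

include hKT hKc hτ in
/-- **The stable truncated weights merge into a small translation-invariant activity.**
[cite: FriedliVelenik2017, §7.4.3 (Ξ^#_stable)] -/
theorem isSmallTIActivity_Wst (σ σ' : Phase) :
    IsSmallTIActivity (M.rhoHat σ (M.Wst (τ - 4 ^ (d + 2)) σ')) (2 * d + 1) :=
  isSmallTIActivity_rhoHat (τ := τ - 4 ^ (d + 2)) T (fun γ => (Wst_nonneg_le _ _ γ).1)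
    (fun γ _ => (Wst_nonneg_le _ _ γ).2.trans (Khat_le_exp _ γ))
    (fun v γ => by simp only [Wst, stable_shift_iff, Khat, hKT, size_shift]) hKc (by positivity)
    (by convert hτ using 3; ring)

include hρτ hρT hKc hτ in
/-- **The unstable-contour gas has small translation-invariant activity** (`w_* ≤ e^{-τ̂|γ̄|}` since
`3^{d+1} + 1 + 3^d ≤ 4^{d+2}`). [cite: FriedliVelenik2017, §7.4.3 ("Since βρ₀ - 5 ≥ τ, ĝ^#_* can be controlled")] -/
theorem isSmallTIActivity_Wstar (σ σ' : Phase) :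
    IsSmallTIActivity (M.rhoHat σ (M.Wstar (τ - 4 ^ (d + 2)) σ')) (2 * d + 1) := by
  refine isSmallTIActivity_rhoHat (τ := τ - 4 ^ (d + 2)) T (fun γ => Wstar_nonneg _ _ γ) (fun γ _ => ?_)
    (fun v γ => by simp only [Wstar, stable_shift_iff, hρT, size_shift]) hKc (by positivity) (by convert hτ using 3; ring)
  unfold Wstar
  split_ifs
  · exact Real.exp_nonneg _
  · calc M.ρ γ * Real.exp ((3 ^ (d + 1) + 1 + 3 ^ d) * M.size γ)
        ≤ Real.exp (-τ * M.size γ) * Real.exp ((3 ^ (d + 1) + 1 + 3 ^ d) * M.size γ) :=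
          mul_le_mul_of_nonneg_right (hρτ γ) (Real.exp_nonneg _)
      _ ≤ Real.exp (-(τ - 4 ^ (d + 2)) * M.size γ) := by
          rw [← Real.exp_add]
          refine Real.exp_le_exp.2 ?_
          have := (three_pow_bounds d).2
          have hn : (0 : ℝ) ≤ M.size γ := Nat.cast_nonneg _
          nlinarith

end Smallness

/-! ### Step (II): stable contours in the induction have small Pirogov–Sinai weights -/

/-- **The volume bound of the induction** `(7.68)`: `Z_σ(V) ≤ e^{ψ̂|V| + 2|∂^in V|}` for all volumes of
size `≤ N` with `★`-connected complement. [cite: FriedliVelenik2017, §7.4.3, Prop. 7.34, eq. (7.68)] -/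
def VolBound (M : ContourModel d) (τh : ℝ) (N : ℕ) : Prop :=
  ∀ (σ : Phase) (V : Finset (Site d)), StarConn (V : Set (Site d))ᶜ → #V ≤ N →
    M.Z σ V ≤ Real.exp (M.psiMax τh * #V + 2 * #(inBoundary V))

/-- **Step (II) of the induction** (FV (7.77)–(7.80), pointwise): under the volume bound for volumes of
size `≤ N`, a `σ`-stable contour of type `σ` whose interior components have size `≤ N` has
`K(γ) ≤ e^{-τ̂|γ̄|}` (so `K̂ = K`): the ratios `Z_{σ'}(A)/Z_σ(A)` are at most `e^{a_σ|A| + 3|∂A|}`,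
`Σ |A| ≤ |γ̄|^d`, `Σ |∂A| ≤ 3^d|γ̄|`, stability, and `τ̂ = τ - 4^{d+2}`.
[cite: FriedliVelenik2017, §7.4.3, proof of Prop. 7.34, eqs. (7.77)–(7.80)] -/
theorem K_le_exp_of_stable (hd : 2 ≤ d) (hrec : M.Rec) (T : M.Shift) {τ : ℝ}
    (hρτ : ∀ γ, M.ρ γ ≤ Real.exp (-τ * M.size γ)) (hKT : ∀ v γ, M.K (T.shift v γ) = M.K γ) {Kc : ℕ}
    (hKc : ∀ A, #(M.withSupp A) ≤ Kc ^ #A)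
    (hτ : (Kc : ℝ) * (2 ^ (d + 1) * 9 ^ d) * Real.exp ((2 * d + 2) * 2 ^ d - (τ - 4 ^ (d + 2))) ≤ 1)
    {N : ℕ} (hVB : M.VolBound (τ - 4 ^ (d + 2)) N) {γ : M.Γ} (hst : M.Stable (τ - 4 ^ (d + 2)) (M.type γ) γ)
    (hints : ∀ A ∈ M.ints γ, #A ≤ N) : M.K γ ≤ Real.exp (-(τ - 4 ^ (d + 2)) * M.size γ) := by
  set τh := τ - 4 ^ (d + 2) with hτh
  set σ := M.type γ with hσ
  have hd1 : 1 ≤ d := by omega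
  have hδ : 2 * (d : ℝ) + 1 ≤ 2 * d + 1 := le_rfl
  have hsmall := isSmallTIActivity_Khat T hKT hKc hτ σ
  -- the ratio bound on each interior component
  have hratio : ∀ A ∈ M.ints γ, M.Z (M.lab γ A) A / M.Z σ A ≤
      Real.exp (M.excess τh σ * #A + 3 * #(inBoundary A)) := by
    intro A hA
    have hAc : StarConn (A : Set (Site d))ᶜ := starConn_compl_of_mem_ints hd hA
    have hnum : M.Z (M.lab γ A) A ≤ Real.exp (M.psiMax τh * #A + 2 * #(inBoundary A)) := hVB _ A hAc (hints A hA)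
    -- the denominator: `Z_σ(A) ≥ w^{|A|} Ξ̂_σ(A) ≥ e^{ψ̂_σ|A| - |∂A|}`
    have hden : Real.exp (M.psiHat τh σ * #A - #(inBoundary A)) ≤ M.Z σ A := by
      rw [Z_eq_mul_compSum hd hrec σ hAc]
      have h1 : M.compSum σ (M.Khat τh) A ≤ M.compSum σ M.K A := compSum_mono (fun γ => Khat_nonneg _ γ) (fun γ => Khat_le_K _ γ) A
      have h2 := abs_log_compSum_sub_le hsmall (fun γ => Khat_nonneg _ γ) hd1 hδ A
      have h3 : M.gHat τh σ * #A - #(inBoundary A) ≤ Real.log (M.compSum σ (M.Khat τh) A) := by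
        rw [gHat]; have := (abs_le.1 h2).1; linarith
      have h4 : Real.exp (M.gHat τh σ * #A - #(inBoundary A)) ≤ M.compSum σ M.K A :=
        le_trans (by rw [← Real.exp_log (compSum_pos (fun γ => Khat_nonneg _ γ) A)]; exact Real.exp_le_exp.2 h3) h1
      calc Real.exp (M.psiHat τh σ * #A - #(inBoundary A))
          = M.w σ ^ #A * Real.exp (M.gHat τh σ * #A - #(inBoundary A)) := by
            rw [psiHat, ← Real.exp_log (pow_pos (M.w_pos σ) #A), ← Real.exp_add, Real.log_pow]; ring_nf
        _ ≤ M.w σ ^ #A * M.compSum σ M.K A := mul_le_mul_of_nonneg_left h4 (pow_nonneg (M.w_pos σ).le _)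
    rw [div_le_iff₀ (M.Z_pos σ A)]
    calc M.Z (M.lab γ A) A ≤ Real.exp (M.psiMax τh * #A + 2 * #(inBoundary A)) := hnum
      _ = Real.exp (M.excess τh σ * #A + 3 * #(inBoundary A)) * Real.exp (M.psiHat τh σ * #A - #(inBoundary A)) := by
          rw [← Real.exp_add, excess]; ring_nf
      _ ≤ Real.exp (M.excess τh σ * #A + 3 * #(inBoundary A)) * M.Z σ A := mul_le_mul_of_nonneg_left hden (Real.exp_nonneg _)
  -- the product of the ratios
  have hprod : ∏ A ∈ M.ints γ, M.Z (M.lab γ A) A / M.Z σ A ≤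
      Real.exp (M.excess τh σ * #(M.intr γ) + 3 * (3 ^ d * M.size γ)) := by
    calc ∏ A ∈ M.ints γ, M.Z (M.lab γ A) A / M.Z σ A
        ≤ ∏ A ∈ M.ints γ, Real.exp (M.excess τh σ * #A + 3 * #(inBoundary A)) :=
          prod_le_prod (fun A _ => div_nonneg (M.Z_pos _ _).le (M.Z_pos _ _).le) hratio
      _ = Real.exp (M.excess τh σ * ∑ A ∈ M.ints γ, (#A : ℝ) + 3 * ∑ A ∈ M.ints γ, (#(inBoundary A) : ℝ)) := by
          rw [← Real.exp_sum, sum_add_distrib, mul_sum, mul_sum]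
      _ ≤ Real.exp (M.excess τh σ * #(M.intr γ) + 3 * (3 ^ d * M.size γ)) := by
          refine Real.exp_le_exp.2 (add_le_add ?_ ?_)
          · rw [← Nat.cast_sum, sum_card_ints_eq hd]
          · refine mul_le_mul_of_nonneg_left ?_ (by norm_num)
            exact_mod_cast sum_card_inBoundary_ints_le hd γ
  -- stability: `a_σ |int γ| ≤ a_σ |γ̄|^d ≤ |γ̄|`
  have hvol : M.excess τh σ * #(M.intr γ) ≤ M.size γ := by
    refine le_trans (mul_le_mul_of_nonneg_left ?_ (excess_nonneg τh σ)) hst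
    have h1 : #(M.intr γ) ≤ M.size γ ^ d := (card_le_card (intr_subset_hull γ)).trans (card_hull_le_pow hd γ)
    exact_mod_cast h1
  have h13 := (three_pow_bounds d).1
  calc M.K γ = M.ρ γ * ∏ A ∈ M.ints γ, M.Z (M.lab γ A) A / M.Z σ A := rfl
    _ ≤ Real.exp (-τ * M.size γ) * Real.exp (M.excess τh σ * #(M.intr γ) + 3 * (3 ^ d * M.size γ)) :=
        mul_le_mul (hρτ γ) hprod (prod_nonneg fun A _ => div_nonneg (M.Z_pos _ _).le (M.Z_pos _ _).le) (Real.exp_nonneg _)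
    _ ≤ Real.exp (-τh * M.size γ) := by
        rw [← Real.exp_add]
        refine Real.exp_le_exp.2 ?_
        have hn : (0 : ℝ) ≤ M.size γ := Nat.cast_nonneg _
        have h3 : (3 : ℝ) ^ (d + 1) = 3 * 3 ^ d := by ring
        have h4 := mul_le_mul_of_nonneg_right h13 hn
        rw [hτh]
        nlinarith

end ContourModel

end Literature.Probability.LatticeModels

end
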